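import Mathlib
import Summits.Ventures.HodgeRepro2.T5OrderCounting

/-!
# T6N41Core — the order-of-vanishing core of N4.1 (Tier 6, M2 sub-step N4.1; pre-M2, carrier-free)

Record formalised: route/T5-N4.1-route-1.md v6.7 (= TIER5 v0.50 ll. 1396–1758), PROOF (N4.1.3) steps
(P0)–(P5), (P5″) and (P6)(ii), over functions `ℂ → ℂ` and Mathlib's `meromorphicOrderAt`.  Nothing of
the automorphic datum is fixed here: every printed input enters as a HYPOTHESIS in the shape its M2
display will have (the t6-p5 / t6-p6 pre-M2 pattern, STATUS ll. 4437 / 4548), and the M2 file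
`T6N41Main.lean` will feed the displays N41-H1 (GQT Thm 11.4(ii) = holomorphy under (H_loc)),
N41-H2/H3 (Lapid–Rallis: the local factors are `1/P(q^{-s})` resp. Γ-products, the unramified factor
through base change), N41-H4/H5 (Iwasawa Thm 3.1 / Prop. 4.4: the Hecke L-function of `E` has a
simple pole at `s = 1` iff the character is trivial, and `L(1, η) ≠ 0` otherwise) and Bump (5.23) into
the theorems below — nothing is displayed in this file (TARGET-T6 §7(c): displays live in `T6N41Hyp`).

The order bookkeeping (E1) is p6's ACCEPTED `T5OrderCounting` (p389988), consumed by name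
(TARGET-T6 §7(a): no re-typing).  Contents:

* `exists_tendsto_ne_zero_of_order_eq_zero`, `apply_ne_zero_of_order_eq_zero` — «order 0 at `x`» =
  «holomorphic and non-zero at `x`» (finite non-zero limit; the value itself when analytic);
* (P2) in kernel: `meromorphicAt_inv_eval_cpow` / `meromorphicOrderAt_inv_eval_cpow_le_zero` (a
  finite-place factor `1/P(q^{-s})`, `P ≠ 0`, is meromorphic of order ≤ 0 at every point) and
  `meromorphicAt_Gamma_affine` / `meromorphicOrderAt_Gamma_affine_le_zero` (a Γ-factor
  `Γ(a s + b)`, `a ≠ 0`, is meromorphic of order ≤ 0 at every point);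
* (P3) in kernel: `analyticAt_one_sub_mul_cpow` / `one_sub_mul_cpow_ne_zero` — the removed Euler
  factor `1 − η(ϖ_v) q_v^{-s}` of a unitary character is entire and non-zero for `Re s > 0`;
* (P4)+(P5): `core` — `Λ = Z·L₁·L₂` near `x`, `Z` meromorphic and zero-free (order ≤ 0), each `L_i`
  under the Iwasawa dichotomy, `Λ` analytic at `x` ⟹ both characters non-trivial, `Λ x ≠ 0`,
  `ord_x Z = 0`;
* (P6)(ii): `order_eq_zero_of_mul_nonpos`, `forall_order_eq_zero_of_prod`,
  `forall_local_order_eq_zero` — every removed local factor is finite and non-zero at `x`;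
* (P5″): `partial_order_eq_zero`, `partial_tendsto_ne_zero` — every partial L-function with
  finitely many finite non-zero factors removed is holomorphic and non-zero at `x`;
* the (R1) shapes `R1_complete` and `R1_partial` for the M2 assembler.

§8(d): uses an L-value-free non-vanishing device: NO (N4.1's mechanism is the L-value one of the
record; this file types its order-of-vanishing arithmetic).
-/

namespace Summit.Ventures.HodgeRepro2.T6
namespace N41Core

open Filter Topology
open Summit.Ventures.HodgeRepro2.T5OrderCounting

variable {x : ℂ}

/-! ### Order 0 = holomorphic and non-zero -/

/-- A function meromorphic at `x` with `meromorphicOrderAt f x = 0` has a finite non-zero limit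
at `x` along the punctured neighbourhood filter — the meaning of «holomorphic and non-zero at
`s = 1`» for a function whose value AT the point may be a junk value (route/T5-N4.1-route-1.md
(P5), (P5″)). -/
theorem exists_tendsto_ne_zero_of_order_eq_zero {f : ℂ → ℂ} (hf : MeromorphicAt f x)
    (h0 : meromorphicOrderAt f x = 0) : ∃ c : ℂ, c ≠ 0 ∧ Tendsto f (𝓝[≠] x) (𝓝 c) := by
  obtain ⟨g, hg, hg0, hfg⟩ := (meromorphicOrderAt_ne_top_iff hf).1 (by simp [h0])
  rw [h0, WithTop.untop₀_zero] at hfg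
  refine ⟨g x, hg0, ?_⟩
  have hfg' : f =ᶠ[𝓝[≠] x] g := by
    filter_upwards [hfg] with z hz
    rw [hz, zpow_zero, one_smul]
  exact (hg.continuousAt.tendsto.mono_left nhdsWithin_le_nhds).congr' hfg'.symm

/-- For `f` analytic at `x`, `meromorphicOrderAt f x = 0` gives `f x ≠ 0` (the value is the limit). -/
theorem apply_ne_zero_of_order_eq_zero {f : ℂ → ℂ} (hf : AnalyticAt ℂ f x)
    (h0 : meromorphicOrderAt f x = 0) : f x ≠ 0 := by
  obtain ⟨c, hc, hlim⟩ := exists_tendsto_ne_zero_of_order_eq_zero hf.meromorphicAt h0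
  have h1 : Tendsto f (𝓝[≠] x) (𝓝 (f x)) := hf.continuousAt.tendsto.mono_left nhdsWithin_le_nhds
  rwa [tendsto_nhds_unique h1 hlim]

/-! ### (P2) zero-freeness of the local factors, in kernel -/

/-- `s ↦ P(q^{-s})` is analytic everywhere for a polynomial `P` and a real `q > 0`. -/
theorem analyticAt_eval_cpow (P : Polynomial ℂ) {q : ℝ} (hq : 0 < q) (x : ℂ) :
    AnalyticAt ℂ (fun s : ℂ => P.eval ((q : ℂ) ^ (-s))) x := by
  have h : AnalyticAt ℂ (fun s : ℂ => (q : ℂ) ^ (-s)) x :=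
    analyticAt_const.cpow analyticAt_id.neg (Complex.ofReal_mem_slitPlane.2 hq)
  simpa only [Polynomial.coe_aeval_eq_eval] using h.aeval_polynomial P

/-- The finite-place Lapid–Rallis factor has the shape `1/P(q^{-s})` (N41-H2 at M2); such a function
is meromorphic at every point. -/
theorem meromorphicAt_inv_eval_cpow (P : Polynomial ℂ) {q : ℝ} (hq : 0 < q) (x : ℂ) :
    MeromorphicAt (fun s : ℂ => (P.eval ((q : ℂ) ^ (-s)))⁻¹) x :=
  (analyticAt_eval_cpow P hq x).meromorphicAt.inv

/-- For `P ≠ 0` and `q > 1` the analytic function `s ↦ P(q^{-s})` does not vanish identically near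
any point: the map `t ↦ q^{-(x+t)}`, `t` real, is injective, so a neighbourhood would give
infinitely many roots of `P`. -/
theorem not_eventually_eval_cpow_eq_zero {P : Polynomial ℂ} (hP : P ≠ 0) {q : ℝ} (hq : 1 < q)
    (x : ℂ) : ¬ ∀ᶠ z in 𝓝[≠] x, P.eval ((q : ℂ) ^ (-z)) = 0 := by
  intro h
  obtain ⟨ε, hε, hball⟩ := Metric.mem_nhdsWithin_iff.1 h
  apply hP
  apply Polynomial.eq_zero_of_infinite_isRoot
  have hq0 : (q : ℂ) ≠ 0 := by exact_mod_cast (zero_lt_one.trans hq).ne'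
  have hq0' : (0 : ℝ) ≤ q := (zero_lt_one.trans hq).le
  have hsm : StrictMono (fun y : ℝ => q ^ y) := fun a b hab => Real.rpow_lt_rpow_of_exponent_lt hq hab
  have hinj : Set.InjOn (fun t : ℝ => (q : ℂ) ^ (-(x + (t : ℂ)))) (Set.Ioo 0 ε) := by
    intro t₁ _ t₂ _ heq
    simp only at heq
    rw [neg_add, neg_add, Complex.cpow_add _ _ hq0, Complex.cpow_add _ _ hq0] at heq
    have hne : (q : ℂ) ^ (-x) ≠ 0 := by
      rw [Ne, Complex.cpow_eq_zero_iff]; exact fun h => hq0 h.1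
    have heq' := mul_left_cancel₀ hne heq
    rw [← Complex.ofReal_neg, ← Complex.ofReal_neg, ← Complex.ofReal_cpow hq0',
      ← Complex.ofReal_cpow hq0', Complex.ofReal_inj] at heq'
    exact neg_injective (hsm.injective heq')
  refine Set.Infinite.mono ?_ ((Set.infinite_image_iff hinj).2 (Set.Ioo_infinite hε))
  rintro _ ⟨t, ⟨ht0, htε⟩, rfl⟩
  have hz : x + (t : ℂ) ≠ x := by
    intro h
    have : (t : ℂ) = 0 := by linear_combination h
    exact ht0.ne' (by exact_mod_cast this)
  have hd : dist (x + (t : ℂ)) x < ε := by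
    rw [Complex.dist_eq, add_sub_cancel_left, Complex.norm_real, Real.norm_eq_abs, abs_of_pos ht0]
    exact htε
  exact hball ⟨Metric.mem_ball.2 hd, Set.mem_compl_singleton_iff.2 hz⟩

/-- (P2) at a finite place, in kernel: `1/P(q^{-s})` with `P ≠ 0`, `q > 1` is zero-free — its order
at every point is ≤ 0 (a pole or a finite non-zero value). -/
theorem meromorphicOrderAt_inv_eval_cpow_le_zero {P : Polynomial ℂ} (hP : P ≠ 0) {q : ℝ}
    (hq : 1 < q) (x : ℂ) :
    meromorphicOrderAt (fun s : ℂ => (P.eval ((q : ℂ) ^ (-s)))⁻¹) x ≤ 0 := by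
  have h := analyticAt_eval_cpow P (zero_lt_one.trans hq) x
  have h2 : meromorphicOrderAt (fun s : ℂ => P.eval ((q : ℂ) ^ (-s))) x ≠ ⊤ := by
    rw [Ne, meromorphicOrderAt_eq_top_iff]; exact not_eventually_eval_cpow_eq_zero hP hq x
  exact meromorphicOrderAt_inv_le_zero h h2

/-- `s ↦ Γ(a s + b)⁻¹` is entire (Mathlib's `Complex.differentiable_one_div_Gamma`). -/
theorem analyticAt_inv_Gamma_affine (a b x : ℂ) :
    AnalyticAt ℂ (fun s => (Complex.Gamma (a * s + b))⁻¹) x := by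
  have : Differentiable ℂ (fun s : ℂ => (Complex.Gamma (a * s + b))⁻¹) :=
    Complex.differentiable_one_div_Gamma.comp ((differentiable_id.const_mul a).add_const b)
  exact this.analyticAt x

/-- The archimedean Lapid–Rallis factor is a product of Γ-factors `Γ(a s + b)` (N41-H2 at M2); each
such factor is meromorphic at every point. -/
theorem meromorphicAt_Gamma_affine (a b x : ℂ) :
    MeromorphicAt (fun s => Complex.Gamma (a * s + b)) x := by
  simpa only [Pi.inv_def, inv_inv] using (analyticAt_inv_Gamma_affine a b x).meromorphicAt.inv

/-- For `a ≠ 0`, `Γ(a s + b)⁻¹` does not vanish identically near any point: its zeros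
`a s + b ∈ -ℕ` form a discrete set (two points `x + t·i/a`, `t` real, cannot both be zeros). -/
theorem not_eventually_inv_Gamma_affine_eq_zero {a : ℂ} (ha : a ≠ 0) (b x : ℂ) :
    ¬ ∀ᶠ z in 𝓝[≠] x, (Complex.Gamma (a * z + b))⁻¹ = 0 := by
  intro hev
  obtain ⟨ε, hε, hball⟩ := Metric.mem_nhdsWithin_iff.1 hev
  have hnorm : 0 < ‖a‖ := norm_pos_iff.2 ha
  have key : ∀ t : ℝ, 0 < t → t < ε * ‖a‖ → (a * x + b).im + t = 0 := by
    intro t ht0 htε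
    have hz : x + (t : ℂ) * (Complex.I / a) ≠ x := by
      intro h
      have h' : (t : ℂ) * (Complex.I / a) = 0 := by linear_combination h
      rcases mul_eq_zero.1 h' with h1 | h1
      · exact ht0.ne' (by exact_mod_cast h1)
      · exact (div_ne_zero Complex.I_ne_zero ha) h1
    have hd : dist (x + (t : ℂ) * (Complex.I / a)) x < ε := by
      rw [Complex.dist_eq, add_sub_cancel_left, norm_mul, norm_div, Complex.norm_I,
        Complex.norm_real, Real.norm_eq_abs, abs_of_pos ht0, one_div, ← div_eq_mul_inv,
        div_lt_iff₀ hnorm]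
      exact htε
    have h0 : (Complex.Gamma (a * (x + (t : ℂ) * (Complex.I / a)) + b))⁻¹ = 0 :=
      hball ⟨Metric.mem_ball.2 hd, Set.mem_compl_singleton_iff.2 hz⟩
    rw [inv_eq_zero, Complex.Gamma_eq_zero_iff] at h0
    obtain ⟨m, hm⟩ := h0
    have hrw : a * (x + (t : ℂ) * (Complex.I / a)) + b = (a * x + b) + (t : ℂ) * Complex.I := by
      field_simp
      ring
    rw [hrw] at hm
    have him := congrArg Complex.im hm
    simpa [Complex.add_im, Complex.mul_im] using him
  have h1 := key (ε * ‖a‖ / 2) (by positivity) (by linarith [mul_pos hε hnorm])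
  have h2 := key (ε * ‖a‖ / 4) (by positivity) (by linarith [mul_pos hε hnorm])
  have : ε * ‖a‖ = 0 := by linarith
  exact (mul_pos hε hnorm).ne' this

/-- (P2) at an archimedean place, in kernel: a Γ-factor `Γ(a s + b)`, `a ≠ 0`, is zero-free — its
order at every point is ≤ 0 (Γ has no zeros; its poles are simple). -/
theorem meromorphicOrderAt_Gamma_affine_le_zero {a : ℂ} (ha : a ≠ 0) (b x : ℂ) :
    meromorphicOrderAt (fun s => Complex.Gamma (a * s + b)) x ≤ 0 := by
  have h := analyticAt_inv_Gamma_affine a b x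
  have h2 : meromorphicOrderAt (fun s => (Complex.Gamma (a * s + b))⁻¹) x ≠ ⊤ := by
    rw [Ne, meromorphicOrderAt_eq_top_iff]; exact not_eventually_inv_Gamma_affine_eq_zero ha b x
  simpa only [Pi.inv_def, inv_inv] using meromorphicOrderAt_inv_le_zero h h2

/-! ### (P3) the removed unramified Euler factors of the Hecke characters -/

/-- `s ↦ 1 − a q^{-s}` is entire (`q > 0` real). -/
theorem analyticAt_one_sub_mul_cpow (a : ℂ) {q : ℝ} (hq : 0 < q) (x : ℂ) :
    AnalyticAt ℂ (fun s : ℂ => 1 - a * (q : ℂ) ^ (-s)) x :=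
  analyticAt_const.sub (analyticAt_const.mul
    (analyticAt_const.cpow analyticAt_id.neg (Complex.ofReal_mem_slitPlane.2 hq)))

/-- (P3) / T5 col. 4: for `‖a‖ ≤ 1` (a unitary character value) and `q > 1`, the Euler factor
`1 − a q^{-s}` is non-zero whenever `Re s > 0` — in particular at `s = 1`, since `‖a q^{-1}‖ < 1`. -/
theorem one_sub_mul_cpow_ne_zero {a : ℂ} (ha : ‖a‖ ≤ 1) {q : ℝ} (hq : 1 < q) {x : ℂ}
    (hx : 0 < x.re) : 1 - a * (q : ℂ) ^ (-x) ≠ 0 := by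
  intro h
  have h1 : a * (q : ℂ) ^ (-x) = 1 := by linear_combination -h
  have h2 : ‖a * (q : ℂ) ^ (-x)‖ < 1 := by
    rw [norm_mul, Complex.norm_cpow_eq_rpow_re_of_pos (zero_lt_one.trans hq), Complex.neg_re]
    calc ‖a‖ * q ^ (-x.re) ≤ 1 * q ^ (-x.re) := by gcongr
      _ = q ^ (-x.re) := one_mul _
      _ < 1 := Real.rpow_lt_one_of_one_lt_of_neg hq (by linarith)
  rw [h1, norm_one] at h2
  exact lt_irrefl _ h2

/-! ### (P4) + (P5): the core -/

/-- **N4.1 (P4)+(P5), the order-of-vanishing core.** Near `x` (= `s = 1`) let `Λ = Z · L₁ · L₂` with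
`Z` meromorphic and zero-free (`ord_x Z ≤ 0`: (P2)+(P3)), and let each `L_i` (the finite Hecke
L-function of the character `η_i′` of `E`) satisfy the Iwasawa dichotomy (Thm 3.1 + Prop. 4.4, the
displays N41-H4 / N41-H5 at M2): if `η_i′` is trivial (`ηᵢtriv`) then `ord_x L_i = −1`, and if not
then `L_i` is analytic at `x` with `L_i x ≠ 0`.  If `Λ` is analytic at `x` (GQT Thm 11.4(ii) under
`(H_loc)`, display N41-H1 at M2), then both characters are non-trivial, `Λ x ≠ 0`, and `ord_x Z = 0`.
The trivial-character case is excluded exactly as in (P4): a simple pole of `L_i` against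
`ord Z ≤ 0` and `ord L_j ≤ 0` would force a pole of `Λ` (`meromorphicOrderAt_neg_of_simple_pole`). -/
theorem core {Λ Z L₁ L₂ : ℂ → ℂ} {η₁triv η₂triv : Prop}
    (hΛ : Λ =ᶠ[𝓝[≠] x] Z * L₁ * L₂)
    (hZ : MeromorphicAt Z x) (hZ0 : meromorphicOrderAt Z x ≤ 0)
    (h₁ : MeromorphicAt L₁ x) (h₂ : MeromorphicAt L₂ x)
    (hI₁ : η₁triv → meromorphicOrderAt L₁ x = -1)
    (hI₁' : ¬ η₁triv → AnalyticAt ℂ L₁ x ∧ L₁ x ≠ 0)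
    (hI₂ : η₂triv → meromorphicOrderAt L₂ x = -1)
    (hI₂' : ¬ η₂triv → AnalyticAt ℂ L₂ x ∧ L₂ x ≠ 0)
    (hhol : AnalyticAt ℂ Λ x) :
    ¬ η₁triv ∧ ¬ η₂triv ∧ Λ x ≠ 0 ∧ meromorphicOrderAt Z x = 0 := by
  have hord : meromorphicOrderAt (Z * L₁ * L₂) x = meromorphicOrderAt Λ x :=
    (meromorphicOrderAt_congr hΛ).symm
  have hΛ0 : 0 ≤ meromorphicOrderAt Λ x := hhol.meromorphicOrderAt_nonneg
  have hle₁ : meromorphicOrderAt L₁ x ≤ 0 := by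
    by_cases h : η₁triv
    · rw [hI₁ h]; decide
    · rw [meromorphicOrderAt_eq_zero_of_ne_zero (hI₁' h).1 (hI₁' h).2]
  have hle₂ : meromorphicOrderAt L₂ x ≤ 0 := by
    by_cases h : η₂triv
    · rw [hI₂ h]; decide
    · rw [meromorphicOrderAt_eq_zero_of_ne_zero (hI₂' h).1 (hI₂' h).2]
  have hn₁ : ¬ η₁triv := fun h => by
    have := meromorphicOrderAt_neg_of_simple_pole hZ h₁ h₂ hZ0 (hI₁ h) hle₂
    rw [hord] at this
    exact absurd hΛ0 (not_le.2 this)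
  have hn₂ : ¬ η₂triv := fun h => by
    have := meromorphicOrderAt_neg_of_simple_pole hZ h₂ h₁ hZ0 (hI₂ h) hle₁
    rw [mul_right_comm, hord] at this
    exact absurd hΛ0 (not_le.2 this)
  have o₁ : meromorphicOrderAt L₁ x = 0 :=
    meromorphicOrderAt_eq_zero_of_ne_zero (hI₁' hn₁).1 (hI₁' hn₁).2
  have o₂ : meromorphicOrderAt L₂ x = 0 :=
    meromorphicOrderAt_eq_zero_of_ne_zero (hI₂' hn₂).1 (hI₂' hn₂).2
  have htriple := meromorphicOrderAt_triple hZ h₁ h₂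
  rw [hord, o₁, o₂, add_zero, add_zero] at htriple
  have hZ' : meromorphicOrderAt Z x = 0 := le_antisymm hZ0 (htriple ▸ hΛ0)
  have hΛ' : meromorphicOrderAt Λ x = 0 := by rw [htriple, hZ']
  exact ⟨hn₁, hn₂, apply_ne_zero_of_order_eq_zero hhol hΛ', hZ'⟩

/-! ### (P6)(ii): every removed local factor is finite and non-zero at `x` -/

/-- Two orders `≤ 0` summing to `0` are both `0` (in `WithTop ℤ`). -/
theorem eq_zero_and_eq_zero_of_add_eq_zero {a b : WithTop ℤ} (ha : a ≤ 0) (hb : b ≤ 0)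
    (hab : a + b = 0) : a = 0 ∧ b = 0 := by
  have ha' : a = 0 := by
    refine le_antisymm ha ?_
    calc (0 : WithTop ℤ) = a + b := hab.symm
      _ ≤ a + 0 := by gcongr
      _ = a := add_zero a
  refine ⟨ha', ?_⟩
  rw [ha', zero_add] at hab
  exact hab

/-- (P6)(ii) for a product of two zero-free factors: `ord (f·g) = 0` with `ord f ≤ 0`, `ord g ≤ 0`
forces `ord f = ord g = 0`. -/
theorem order_eq_zero_of_mul_nonpos {f g : ℂ → ℂ} (hf : MeromorphicAt f x) (hg : MeromorphicAt g x)
    (hf0 : meromorphicOrderAt f x ≤ 0) (hg0 : meromorphicOrderAt g x ≤ 0)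
    (h : meromorphicOrderAt (f * g) x = 0) :
    meromorphicOrderAt f x = 0 ∧ meromorphicOrderAt g x = 0 := by
  rw [meromorphicOrderAt_mul hf hg] at h
  exact eq_zero_and_eq_zero_of_add_eq_zero hf0 hg0 h

/-- (P6)(ii) for a finite product of zero-free factors: if the product has order `0` at `x` and
every factor has order `≤ 0`, every factor has order exactly `0`. -/
theorem forall_order_eq_zero_of_prod {ι : Type*} {s : Finset ι} {f : ι → ℂ → ℂ}
    (hf : ∀ i ∈ s, MeromorphicAt (f i) x) (hf0 : ∀ i ∈ s, meromorphicOrderAt (f i) x ≤ 0)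
    (hprod : meromorphicOrderAt (∏ i ∈ s, f i) x = 0) :
    ∀ i ∈ s, meromorphicOrderAt (f i) x = 0 := by
  rw [meromorphicOrderAt_prod hf] at hprod
  exact (Finset.sum_eq_zero_iff_of_nonpos hf0).1 hprod

/-- (P6)(ii) as used: if `Z = ∏_{v ∈ S} L_v` near `x` with every `L_v` meromorphic and zero-free
(order ≤ 0) and `ord_x Z = 0` (the conclusion of `core`), then every `L_v` has order `0` at `x`,
i.e. is finite and non-zero there — «EVERY local factor … in particular the three archimedean
factors — is finite at `s = 1`». -/
theorem forall_local_order_eq_zero {Z : ℂ → ℂ} {ι : Type*} {s : Finset ι} {f : ι → ℂ → ℂ}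
    (hZ : Z =ᶠ[𝓝[≠] x] ∏ i ∈ s, f i) (hf : ∀ i ∈ s, MeromorphicAt (f i) x)
    (hf0 : ∀ i ∈ s, meromorphicOrderAt (f i) x ≤ 0) (hZ0 : meromorphicOrderAt Z x = 0) :
    ∀ i ∈ s, meromorphicOrderAt (f i) x = 0 ∧ ∃ c : ℂ, c ≠ 0 ∧ Tendsto (f i) (𝓝[≠] x) (𝓝 c) := by
  have hprod : meromorphicOrderAt (∏ i ∈ s, f i) x = 0 := by
    rw [← meromorphicOrderAt_congr hZ]; exact hZ0
  intro i hi
  have h0 := forall_order_eq_zero_of_prod hf hf0 hprod i hi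
  exact ⟨h0, exists_tendsto_ne_zero_of_order_eq_zero (hf i hi) h0⟩

/-! ### (P5″): partial L-functions -/

/-- (P5″): if `Λ = P · ∏_{v ∈ S′} L_v` near `x` with `Λ` analytic and non-zero at `x` and every
removed factor `L_v` meromorphic of order `0` at `x`, then the partial product `P` has order `0` at
`x`. -/
theorem partial_order_eq_zero {Λ P : ℂ → ℂ} {ι : Type*} {s : Finset ι} {f : ι → ℂ → ℂ}
    (hΛ : Λ =ᶠ[𝓝[≠] x] P * ∏ i ∈ s, f i)
    (hP : MeromorphicAt P x) (hf : ∀ i ∈ s, MeromorphicAt (f i) x)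
    (hf0 : ∀ i ∈ s, meromorphicOrderAt (f i) x = 0)
    (hhol : AnalyticAt ℂ Λ x) (hne : Λ x ≠ 0) : meromorphicOrderAt P x = 0 := by
  have hΛ0 : meromorphicOrderAt Λ x = 0 := meromorphicOrderAt_eq_zero_of_ne_zero hhol hne
  rw [meromorphicOrderAt_congr hΛ, meromorphicOrderAt_mul hP (MeromorphicAt.prod hf),
    meromorphicOrderAt_prod hf, Finset.sum_eq_zero hf0, add_zero] at hΛ0
  exact hΛ0

/-- (P5″) in the «holomorphic and non-zero at `s = 1`» form: the partial L-function has a finite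
non-zero limit at `x`. -/
theorem partial_tendsto_ne_zero {Λ P : ℂ → ℂ} {ι : Type*} {s : Finset ι} {f : ι → ℂ → ℂ}
    (hΛ : Λ =ᶠ[𝓝[≠] x] P * ∏ i ∈ s, f i)
    (hP : MeromorphicAt P x) (hf : ∀ i ∈ s, MeromorphicAt (f i) x)
    (hf0 : ∀ i ∈ s, meromorphicOrderAt (f i) x = 0)
    (hhol : AnalyticAt ℂ Λ x) (hne : Λ x ≠ 0) :
    ∃ c : ℂ, c ≠ 0 ∧ Tendsto P (𝓝[≠] x) (𝓝 c) :=
  exists_tendsto_ne_zero_of_order_eq_zero hP (partial_order_eq_zero hΛ hP hf hf0 hhol hne)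

/-! ### The (R1) shapes for the M2 assembler -/

/-- **(R1), complete L-function.** The hypotheses of `core` give «`Λ` is holomorphic and non-zero at
`x`» in the form the M2 datum consumes (`AnalyticAt ℂ Λ 1 ∧ Λ 1 ≠ 0`). -/
theorem R1_complete {Λ Z L₁ L₂ : ℂ → ℂ} {η₁triv η₂triv : Prop}
    (hΛ : Λ =ᶠ[𝓝[≠] x] Z * L₁ * L₂)
    (hZ : MeromorphicAt Z x) (hZ0 : meromorphicOrderAt Z x ≤ 0)
    (h₁ : MeromorphicAt L₁ x) (h₂ : MeromorphicAt L₂ x)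
    (hI₁ : η₁triv → meromorphicOrderAt L₁ x = -1)
    (hI₁' : ¬ η₁triv → AnalyticAt ℂ L₁ x ∧ L₁ x ≠ 0)
    (hI₂ : η₂triv → meromorphicOrderAt L₂ x = -1)
    (hI₂' : ¬ η₂triv → AnalyticAt ℂ L₂ x ∧ L₂ x ≠ 0)
    (hhol : AnalyticAt ℂ Λ x) : AnalyticAt ℂ Λ x ∧ Λ x ≠ 0 :=
  ⟨hhol, (core hΛ hZ hZ0 h₁ h₂ hI₁ hI₁' hI₂ hI₂' hhol).2.2.1⟩

/-- **(R1), partial L-function.** Under the hypotheses of `core`, every partial L-function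
`P = L^{S′}` with `Λ = P · ∏_{v ∈ S′} L_v` near `x` and the removed factors of order `0` at `x`
(from `forall_local_order_eq_zero` for `v ∈ S`, from `one_sub_mul_cpow_ne_zero` for `v ∉ S`) is
holomorphic and non-zero at `x`: order `0` and a finite non-zero limit. -/
theorem R1_partial {Λ Z L₁ L₂ P : ℂ → ℂ} {η₁triv η₂triv : Prop} {ι : Type*} {s : Finset ι}
    {f : ι → ℂ → ℂ}
    (hΛ : Λ =ᶠ[𝓝[≠] x] Z * L₁ * L₂)
    (hZ : MeromorphicAt Z x) (hZ0 : meromorphicOrderAt Z x ≤ 0)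
    (h₁ : MeromorphicAt L₁ x) (h₂ : MeromorphicAt L₂ x)
    (hI₁ : η₁triv → meromorphicOrderAt L₁ x = -1)
    (hI₁' : ¬ η₁triv → AnalyticAt ℂ L₁ x ∧ L₁ x ≠ 0)
    (hI₂ : η₂triv → meromorphicOrderAt L₂ x = -1)
    (hI₂' : ¬ η₂triv → AnalyticAt ℂ L₂ x ∧ L₂ x ≠ 0)
    (hhol : AnalyticAt ℂ Λ x)
    (hΛP : Λ =ᶠ[𝓝[≠] x] P * ∏ i ∈ s, f i)
    (hP : MeromorphicAt P x) (hf : ∀ i ∈ s, MeromorphicAt (f i) x)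
    (hf0 : ∀ i ∈ s, meromorphicOrderAt (f i) x = 0) :
    meromorphicOrderAt P x = 0 ∧ ∃ c : ℂ, c ≠ 0 ∧ Tendsto P (𝓝[≠] x) (𝓝 c) := by
  have hne : Λ x ≠ 0 := (core hΛ hZ hZ0 h₁ h₂ hI₁ hI₁' hI₂ hI₂' hhol).2.2.1
  exact ⟨partial_order_eq_zero hΛP hP hf hf0 hhol hne,
    partial_tendsto_ne_zero hΛP hP hf hf0 hhol hne⟩

end N41Core
end Summit.Ventures.HodgeRepro2.T6
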